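import Summits.CriticalPhenomena.PercolationContinuityZ3.Theorems.FK.SteepnessFK
import HarnessLib

/-!
# The Hamming distance to an increasing event dominates the number of failed disjoint sub-events
# (Grimmett 2006, proof of Lemma (5.71), (5.75) and (5.79): `H_n ≥ Σ_i F_i ≥ #{i : L_i fails}`)

Claimed R42 (8)(c) in the cell INBOX at 2026-08-27T12:45:21Z by fkp-10a gen 349 (NEW CLAIM #2 of the gen), addressed to coordinator fk-4 g257 (seated 11:08Z 2026-08-27; R135 l.8027); lineage row FO-10a-g349n (self-suggested), package g349-nearexp, label NX-A.
Support file of the `fk-continuity` cell (lineage fkp-10a, `--supports stmt-CriticalPhenomena-4575`); builds on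
p205010 (kernel theorem, internal audit signed; external expert review pending).  No definitions, no named facts,
no sorries; standard axioms.  Measure-free combinatorics plus one integration step; any index type.

Grimmett 2006, proof of Lemma (5.71), p. 115–116: with `L_i = {∂Λ_{R_i} ↔ ∂Λ_{R_{i+1}}}` and `F_i = H_{L_i}`,
"(5.75) `H_n ≥ Σ_{i<K} F_i`, since every path from `0` to `∂Λ_n` traverses each annulus" and "(5.79) `F_i ≥ 1` if
`L_i` does not occur, whence `φ(H_n) ≥ Σ_i [1 - φ(L_i)]`".  The abstract content: if an increasing event `A`
determined by `F` is contained in events `L_i` (`i ∈ I`, finite), each `L_i` determined by a set `E_i ⊆ F` of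
edges, the `E_i` pairwise disjoint, then opening `k` edges can repair at most `k` of the failed `L_i`:
`{H_A^F ≤ k} ⊆ {#{i : ω ∉ L_i} ≤ k}` (`withinDist_subset_setOf_card_filter_le`), and consequently, for every finite
measure `μ`, the mean Hamming distance in its layer-cake form dominates the expected number of failures:
`Σ_{k<|F|} (μ(univ) - μ{H_A^F ≤ k}) ≥ Σ_i (μ(univ) - μ(L_i))` (`sum_sub_real_le_sum_sub_real_withinDist`; no bound on
`|I|` is needed: the number of failures never exceeds `H_A^F ≤ |F|`).
This is the input of the annulus iteration (5.75)–(5.81) on top of (5.68) (`SteepnessBoxLimits.lean`).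

## Contents (namespace `Summit.CriticalPhenomena.PercolationContinuityZ3.Theorems.FK`)

* `mem_of_union_mem_of_disjoint` (an event determined by `E` ignores added edges off `E`);
* **`withinDist_subset_setOf_card_filter_le`** (`{H_A^F ≤ k} ⊆ {#{i : ω ∉ L_i} ≤ k}`);
* `sum_ite_lt_eq_self` (layer cake of a bounded count);
* **`sum_sub_real_le_sum_sub_real_withinDist`** (`Σ_i (μ univ - μ(L_i)) ≤ Σ_{k<|F|} (μ univ - μ{H_A^F ≤ k})`).

## References

* G. Grimmett, *The Random-Cluster Model*, Springer 2006: proof of Lemma (5.71), (5.75), (5.79), pp. 115–116.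
  [Grimmett2006]
-/

noncomputable section

open scoped Classical
open MeasureTheory Finset

namespace Summit.CriticalPhenomena.PercolationContinuityZ3.Theorems

namespace FK

open Literature.Probability.LatticeModels Literature.Probability.Percolation
  Literature.Probability.Percolation.Steepness

variable {V : Type*} {ι : Type*}

/-! ### Opening `k` edges repairs at most `k` disjointly-determined events -/

/-- An event determined by `E` is insensitive to adding edges off `E`: if `S ∩ E = ∅` then
`ω ∪ S ∈ L ↔ ω ∈ L`. [folklore] -/
theorem mem_of_union_mem_of_disjoint {L : Set (BondConfig V)} {E : Set (Sym2 V)} (hL : DeterminedBy L E)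
    {ω : BondConfig V} {S : Set (Sym2 V)} (hS : Disjoint S E) (h : ω ∪ S ∈ L) : ω ∈ L := by
  refine ((determinedBy_iff L E).1 hL ω (ω ∪ S) ?_).2 h
  rw [Set.union_inter_distrib_right, Set.disjoint_iff_inter_eq_empty.1 hS, Set.union_empty]

/-- **`{H_A^F ≤ k} ⊆ {#{i : ω ∉ L_i} ≤ k}`** (Grimmett 2006, proof of Lemma (5.71), (5.75) with (5.79)): if the
increasing event `A` is contained in every `L_i`, `i ∈ I`, where `L_i` is determined by `E_i` and the `E_i` are
pairwise disjoint, then a configuration that enters `A` by opening a set `S ⊆ F` of at most `k` edges fails at most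
`k` of the `L_i` (each failed `L_i` needs an edge of `S` inside `E_i`).
[cite: Grimmett2006, proof of Lemma (5.71), (5.75) and (5.79) pp. 115–116] -/
theorem withinDist_subset_setOf_card_filter_le {F : Finset (Sym2 V)} {A : Set (BondConfig V)} (I : Finset ι)
    {L : ι → Set (BondConfig V)} {E : ι → Set (Sym2 V)} (hAL : ∀ i ∈ I, A ⊆ L i)
    (hLE : ∀ i ∈ I, DeterminedBy (L i) (E i)) (hdisj : (↑I : Set ι).PairwiseDisjoint E) (k : ℕ) :
    withinDist F A k ⊆ {ω | (I.filter (fun i => ω ∉ L i)).card ≤ k} := by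
  rintro ω ⟨S, -, hSk, hS⟩
  simp only [Set.mem_setOf_eq]
  -- every failed `i` owns an edge of `S` in `E i`: the sets `S ∩ E i` are non-empty and pairwise disjoint
  set T : Finset ι := I.filter (fun i => ω ∉ L i) with hT
  have hne : ∀ i ∈ T, (S.filter (fun e => e ∈ E i)).Nonempty := by
    intro i hi
    obtain ⟨hiI, hiL⟩ := Finset.mem_filter.1 hi
    by_contra hcon
    rw [Finset.not_nonempty_iff_eq_empty, Finset.filter_eq_empty_iff] at hcon
    have hdis : Disjoint (↑S : Set (Sym2 V)) (E i) :=
      Set.disjoint_left.2 fun e he heE => hcon he heE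
    exact hiL (mem_of_union_mem_of_disjoint (hLE i hiI) hdis (hAL i hiI hS))
  have hdisj' : ∀ i ∈ T, ∀ j ∈ T, i ≠ j →
      Disjoint (S.filter (fun e => e ∈ E i)) (S.filter (fun e => e ∈ E j)) := by
    intro i hi j hj hij
    have hd := hdisj (Finset.mem_filter.1 hi).1 (Finset.mem_filter.1 hj).1 hij
    exact Finset.disjoint_filter.2 fun e _ hei hej => Set.disjoint_left.1 hd hei hej
  calc T.card = ∑ i ∈ T, 1 := Finset.card_eq_sum_ones T
    _ ≤ ∑ i ∈ T, (S.filter (fun e => e ∈ E i)).card :=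
        Finset.sum_le_sum fun i hi => Finset.one_le_card.2 (hne i hi)
    _ = (T.biUnion fun i => S.filter (fun e => e ∈ E i)).card := (Finset.card_biUnion hdisj').symm
    _ ≤ S.card := Finset.card_le_card (Finset.biUnion_subset.2 fun i _ => Finset.filter_subset _ _)
    _ ≤ k := hSk

/-! ### The layer cake of a bounded count -/

/-- Layer cake of a bounded count: `Σ_{k<M} 1{k < c} = c` for `c ≤ M`. [folklore] -/
theorem sum_ite_lt_eq_self {c M : ℕ} (h : c ≤ M) :
    ∑ k ∈ Finset.range M, (if k < c then (1 : ℝ) else 0) = (c : ℝ) := by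
  rw [Finset.sum_ite, Finset.sum_const_zero, add_zero, Finset.sum_const, nsmul_eq_mul, mul_one]
  have : (Finset.range M).filter (fun k => k < c) = Finset.range c := by
    ext k
    simp only [Finset.mem_filter, Finset.mem_range]
    constructor
    · exact fun h' => h'.2
    · exact fun h' => ⟨lt_of_lt_of_le h' h, h'⟩
  rw [this, Finset.card_range]

/-! ### Integration: the mean Hamming distance dominates the expected number of failures -/

/-- **`Σ_i (μ univ - μ(L_i)) ≤ Σ_{k<|F|} (μ univ - μ{H_A^F ≤ k})`** (Grimmett 2006, proof of Lemma (5.71), (5.79):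
`φ(H_n) ≥ Σ_i [1 - φ(L_i)]`): for a finite measure `μ` on bond configurations, an increasing event `A ⊆ ⋂_i L_i`
with `L_i` measurable and determined by pairwise disjoint edge sets `E_i`, `A` non-empty and determined by `F` (no
measurability of the `{H_A^F ≤ k}` is needed: the failure events are Boolean combinations of the `L_i`).  (For a probability
measure the left side is `Σ_i (1 - μ(L_i))` and the right side is the mean Hamming distance `μ(H_A^F)` in the
layer-cake form of `SteepnessFK.lean`.)  Proof: integrate the pointwise layer cake
`Σ_{k<|F|} 1{#fails > k} = #fails = Σ_i 1{ω ∉ L_i}` and use `{H_A^F ≤ k} ⊆ {#fails ≤ k}`.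
[cite: Grimmett2006, proof of Lemma (5.71), (5.79) p. 116] -/
theorem sum_sub_real_le_sum_sub_real_withinDist {μ : Measure (BondConfig V)} [IsFiniteMeasure μ]
    {F : Finset (Sym2 V)} {A : Set (BondConfig V)} (hA : IsUpperSet A) (hAF : DeterminedBy A (↑F : Set (Sym2 V)))
    (hne : A.Nonempty) (I : Finset ι) {L : ι → Set (BondConfig V)}
    {E : ι → Set (Sym2 V)} (hAL : ∀ i ∈ I, A ⊆ L i) (hLE : ∀ i ∈ I, DeterminedBy (L i) (E i))
    (hdisj : (↑I : Set ι).PairwiseDisjoint E) (hLm : ∀ i ∈ I, MeasurableSet (L i)) :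
    ∑ i ∈ I, (μ.real Set.univ - μ.real (L i)) ≤
      ∑ k ∈ Finset.range F.card, (μ.real Set.univ - μ.real (withinDist F A k)) := by
  -- the "failure count exceeds k" events
  set N : ℕ → Set (BondConfig V) := fun k => {ω | k < (I.filter (fun i => ω ∉ L i)).card} with hN
  have hNm : ∀ k, MeasurableSet (N k) := by
    intro k
    -- `N k` is a finite Boolean combination of the `L i`: write it through the indicator sum
    have : N k = {ω | (k : ℝ) < ∑ i ∈ I, (if ω ∉ L i then (1 : ℝ) else 0)} := by
      ext ω
      simp only [hN, Set.mem_setOf_eq, ← Finset.natCast_card_filter, Nat.cast_lt]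
    rw [this]
    refine measurableSet_lt measurable_const (Finset.measurable_sum _ fun i hi => ?_)
    exact Measurable.ite ((hLm i hi).compl) measurable_const measurable_const
  -- step 1: `μ univ - μ(W_k) ≥ μ(N k)` since `W_k ⊆ (N k)ᶜ`
  have hstep1 : ∀ k, μ.real (N k) ≤ μ.real Set.univ - μ.real (withinDist F A k) := by
    intro k
    have hsub : withinDist F A k ⊆ (N k)ᶜ := by
      intro ω hω
      have := withinDist_subset_setOf_card_filter_le I hAL hLE hdisj k hω
      simp only [hN, Set.mem_compl_iff, Set.mem_setOf_eq, not_lt]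
      exact this
    have h1 : μ.real (withinDist F A k) + μ.real (N k) ≤ μ.real Set.univ := by
      rw [← measureReal_union (Set.disjoint_left.2 fun ω hω hω' => hsub hω hω') (hNm k)]
      exact measureReal_mono (Set.subset_univ _)
    linarith
  -- step 2: `Σ_{k<|F|} μ(N k) = Σ_i (μ univ - μ(L i))` (integrate the pointwise layer cake)
  have hstep2 : ∑ k ∈ Finset.range F.card, μ.real (N k) = ∑ i ∈ I, (μ.real Set.univ - μ.real (L i)) := by
    have hint : ∀ k, μ.real (N k) = ∫ ω, (N k).indicator (1 : BondConfig V → ℝ) ω ∂μ := fun k =>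
      (integral_indicator_one (hNm k)).symm
    have hint' : ∀ i ∈ I, μ.real Set.univ - μ.real (L i) = ∫ ω, (L i)ᶜ.indicator (1 : BondConfig V → ℝ) ω ∂μ := by
      intro i hi
      rw [integral_indicator_one (hLm i hi).compl, measureReal_compl (hLm i hi)]
    rw [Finset.sum_congr rfl fun k _ => hint k, Finset.sum_congr rfl hint',
      ← integral_finsetSum _ fun k _ => (integrable_const _).indicator (hNm k),
      ← integral_finsetSum _ fun i hi => (integrable_const _).indicator (hLm i hi).compl]
    refine integral_congr_ae (Filter.Eventually.of_forall fun ω => ?_)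
    -- pointwise layer cake
    have h1 : ∀ k, (N k).indicator (1 : BondConfig V → ℝ) ω =
        if k < (I.filter (fun i => ω ∉ L i)).card then 1 else 0 :=
      fun k => by simp only [Set.indicator_apply, hN, Set.mem_setOf_eq, Pi.one_apply]
    have h2 : ∀ i, (L i)ᶜ.indicator (1 : BondConfig V → ℝ) ω = if ω ∉ L i then 1 else 0 :=
      fun i => by simp only [Set.indicator_apply, Set.mem_compl_iff, Pi.one_apply]
    simp only [h1, h2]
    -- the failure count never exceeds `|F|`: opening all of `F` enters `A ⊆ ⋂ L_i`
    have hNF : (I.filter (fun i => ω ∉ L i)).card ≤ F.card :=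
      withinDist_subset_setOf_card_filter_le I hAL hLE hdisj F.card (mem_withinDist_card hA hAF hne ω)
    rw [sum_ite_lt_eq_self hNF, Finset.natCast_card_filter]
  rw [← hstep2]
  exact Finset.sum_le_sum fun k _ => hstep1 k

end FK

end Summit.CriticalPhenomena.PercolationContinuityZ3.Theorems

end
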